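import Summits.RiemannHypothesis.RiemannHypothesis.Theorems.SemilocalNegCertUptoHundredThirtyOneKinkedG
import Summits.RiemannHypothesis.RiemannHypothesis.Theorems.SemilocalNegCertUptoHundredThirtyOneKinkedH
import Summits.RiemannHypothesis.RiemannHypothesis.Theorems.SemilocalNegCertUptoHundredThirtyOneKinkedI
import Summits.RiemannHypothesis.RiemannHypothesis.Theorems.SemilocalNegCertUptoHundredThirtyOneKinkedJ
import Summits.RiemannHypothesis.RiemannHypothesis.Theorems.SemilocalNegCertUptoHundredThirtyOneKinkedK
import Summits.RiemannHypothesis.RiemannHypothesis.Theorems.SemilocalNegCertUptoHundredThirtyOneKinkedL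
import Summits.RiemannHypothesis.RiemannHypothesis.Theorems.SemilocalNegCertUptoHundredThirtyOneKinkedM
import Summits.RiemannHypothesis.RiemannHypothesis.Theorems.SemilocalNegCertUptoHundredThirtyOneKinkedN
import Summits.RiemannHypothesis.RiemannHypothesis.Theorems.SemilocalNegCertUptoHundredThirtyOneKinkedO
import Summits.RiemannHypothesis.RiemannHypothesis.Theorems.SemilocalNegCertUptoHundredThirtyOneKinkedP
import HarnessLib

/-!
# Semi-local threshold of the `{∞} ∪ {p < 137}` form, negative side: `a*({2,…,131}) ≤ 1263/512` — the wall `q = 137` from a KINKED (piecewise-cubic) witness (part 11/14: the composition of the piece facts 150 … 299)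

Cell `rh-explicit` (HOME `run/shared/lean/pub/rh-explicit/`), seat cc-s2-4 (A4 SEMILOCAL-TABLE, kernel column; pipeline gen11 `mkkinked.py`).
Honest framing: theorems about the tree's `weilSemilocalThreshold S`; nothing here bears on RH.  No data is trusted: every bound is a
`decide +kernel` fact of the piecewise certificate `SemilocalPiecewiseCert.lean` (cc-s2-4 gen8).

Instance: `S = {p < 137}`, window `b = 1263/512` (last /1024 value below `(log 139)/2`), `N = 138`, 45 atoms; odd piecewise-cubic
witness with 20 slope breaks at the atom images `|b − log n|` nearest `0` (atoms `n = 11, 13, 9, 16, 17, 8, 19, 7, 23, 25, 27, 5, 29, 31, 32, 4, 37, 41, 43, 3`,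
rounded to `/1024`); float finder `Re Q/‖G‖² = -2.626e-04` (no polar credit); orders `(10, 4, 8, 4, 10, 40)`, 437 `t`-pieces
(far widths ≤ 1/4); exact kernel margin `(rhs − lhs)/‖G‖² = 2.6311e-04`.  ⇒ **`a*({p < 137}) ≤ 1263/512 < (log 139)/2`**.
The instance is split for the gate into part 1
(table, certificate, `checkMainPW`, the atom side in kernel chunks of ≤ 4 atoms via `SemilocalPiecewiseCertSplit.lean`), parts 2–8
(68 piece facts each in the FLEX layout of `SemilocalPiecewiseCertFlex.lean` (cc-s2-4 gen12, CC4-LEAN §17.2): piece `0` by `checkPiecePW`,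
every far piece by `checkPieceFlex i ⟨n, m, K, m', u₀⟩` with the orders that piece needs (mean majorant degree ≈ 62 instead of 176) and a
short dyadic centre `u₀ ≤ u_K(T₀)` — same witness, same cuts, claims recomputed (`⌈exact⌉ + 1`), kernel margin `2.6309e-04`·‖G‖²; each
fact file imports part 1 only), the Pieces part (composition) and the Final part (theorems).  Folklore throughout.
-/

set_option autoImplicit false
set_option linter.dupNamespace false  -- the mandated namespace repeats `RiemannHypothesis`
set_option Elab.async false  -- serialise the kernel facts: in parallel they exhaust the node's per-process heap (cc-s2-4 gen11, CC4-LEAN §16.10)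

noncomputable section

open Complex Filter Set MeasureTheory Topology
open scoped Real

namespace Summit.RiemannHypothesis.RiemannHypothesis.Theorems.SemilocalPolyWitness

open MeasureTheory Set Finset Real
open Literature.NumberTheory.LFunctions
open Summit.RiemannHypothesis.RiemannHypothesis.Theorems.MotivicDoor
open Summit.RiemannHypothesis.RiemannHypothesis.Theorems.MotivicDoor.SemilocalThreshold
open Summit.RiemannHypothesis.RiemannHypothesis.Theorems.MotivicDoor.SemilocalMarkov
open LQ

/-- pieces `150 ≤ i < 300` of `certUptoHundredThirtyOneKinked` check (FLEX form). -/
theorem check_UptoHundredThirtyOneKinked_pieces_2 : ∀ i, 150 ≤ i → i < 300 →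
    certUptoHundredThirtyOneKinked.checkPiecePW i = true ∨ ∃ o, certUptoHundredThirtyOneKinked.checkPieceFlex i o = true := by
  intro i hlo hhi
  interval_cases i
  · exact Or.inr ⟨_, check_UptoHundredThirtyOneKinked_piece150⟩
  · exact Or.inr ⟨_, check_UptoHundredThirtyOneKinked_piece151⟩
  · exact Or.inr ⟨_, check_UptoHundredThirtyOneKinked_piece152⟩
  · exact Or.inr ⟨_, check_UptoHundredThirtyOneKinked_piece153⟩
  · exact Or.inr ⟨_, check_UptoHundredThirtyOneKinked_piece154⟩
  · exact Or.inr ⟨_, check_UptoHundredThirtyOneKinked_piece155⟩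
  · exact Or.inr ⟨_, check_UptoHundredThirtyOneKinked_piece156⟩
  · exact Or.inr ⟨_, check_UptoHundredThirtyOneKinked_piece157⟩
  · exact Or.inr ⟨_, check_UptoHundredThirtyOneKinked_piece158⟩
  · exact Or.inr ⟨_, check_UptoHundredThirtyOneKinked_piece159⟩
  · exact Or.inr ⟨_, check_UptoHundredThirtyOneKinked_piece160⟩
  · exact Or.inr ⟨_, check_UptoHundredThirtyOneKinked_piece161⟩
  · exact Or.inr ⟨_, check_UptoHundredThirtyOneKinked_piece162⟩
  · exact Or.inr ⟨_, check_UptoHundredThirtyOneKinked_piece163⟩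
  · exact Or.inr ⟨_, check_UptoHundredThirtyOneKinked_piece164⟩
  · exact Or.inr ⟨_, check_UptoHundredThirtyOneKinked_piece165⟩
  · exact Or.inr ⟨_, check_UptoHundredThirtyOneKinked_piece166⟩
  · exact Or.inr ⟨_, check_UptoHundredThirtyOneKinked_piece167⟩
  · exact Or.inr ⟨_, check_UptoHundredThirtyOneKinked_piece168⟩
  · exact Or.inr ⟨_, check_UptoHundredThirtyOneKinked_piece169⟩
  · exact Or.inr ⟨_, check_UptoHundredThirtyOneKinked_piece170⟩
  · exact Or.inr ⟨_, check_UptoHundredThirtyOneKinked_piece171⟩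
  · exact Or.inr ⟨_, check_UptoHundredThirtyOneKinked_piece172⟩
  · exact Or.inr ⟨_, check_UptoHundredThirtyOneKinked_piece173⟩
  · exact Or.inr ⟨_, check_UptoHundredThirtyOneKinked_piece174⟩
  · exact Or.inr ⟨_, check_UptoHundredThirtyOneKinked_piece175⟩
  · exact Or.inr ⟨_, check_UptoHundredThirtyOneKinked_piece176⟩
  · exact Or.inr ⟨_, check_UptoHundredThirtyOneKinked_piece177⟩
  · exact Or.inr ⟨_, check_UptoHundredThirtyOneKinked_piece178⟩
  · exact Or.inr ⟨_, check_UptoHundredThirtyOneKinked_piece179⟩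
  · exact Or.inr ⟨_, check_UptoHundredThirtyOneKinked_piece180⟩
  · exact Or.inr ⟨_, check_UptoHundredThirtyOneKinked_piece181⟩
  · exact Or.inr ⟨_, check_UptoHundredThirtyOneKinked_piece182⟩
  · exact Or.inr ⟨_, check_UptoHundredThirtyOneKinked_piece183⟩
  · exact Or.inr ⟨_, check_UptoHundredThirtyOneKinked_piece184⟩
  · exact Or.inr ⟨_, check_UptoHundredThirtyOneKinked_piece185⟩
  · exact Or.inr ⟨_, check_UptoHundredThirtyOneKinked_piece186⟩
  · exact Or.inr ⟨_, check_UptoHundredThirtyOneKinked_piece187⟩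
  · exact Or.inr ⟨_, check_UptoHundredThirtyOneKinked_piece188⟩
  · exact Or.inr ⟨_, check_UptoHundredThirtyOneKinked_piece189⟩
  · exact Or.inr ⟨_, check_UptoHundredThirtyOneKinked_piece190⟩
  · exact Or.inr ⟨_, check_UptoHundredThirtyOneKinked_piece191⟩
  · exact Or.inr ⟨_, check_UptoHundredThirtyOneKinked_piece192⟩
  · exact Or.inr ⟨_, check_UptoHundredThirtyOneKinked_piece193⟩
  · exact Or.inr ⟨_, check_UptoHundredThirtyOneKinked_piece194⟩
  · exact Or.inr ⟨_, check_UptoHundredThirtyOneKinked_piece195⟩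
  · exact Or.inr ⟨_, check_UptoHundredThirtyOneKinked_piece196⟩
  · exact Or.inr ⟨_, check_UptoHundredThirtyOneKinked_piece197⟩
  · exact Or.inr ⟨_, check_UptoHundredThirtyOneKinked_piece198⟩
  · exact Or.inr ⟨_, check_UptoHundredThirtyOneKinked_piece199⟩
  · exact Or.inr ⟨_, check_UptoHundredThirtyOneKinked_piece200⟩
  · exact Or.inr ⟨_, check_UptoHundredThirtyOneKinked_piece201⟩
  · exact Or.inr ⟨_, check_UptoHundredThirtyOneKinked_piece202⟩
  · exact Or.inr ⟨_, check_UptoHundredThirtyOneKinked_piece203⟩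
  · exact Or.inr ⟨_, check_UptoHundredThirtyOneKinked_piece204⟩
  · exact Or.inr ⟨_, check_UptoHundredThirtyOneKinked_piece205⟩
  · exact Or.inr ⟨_, check_UptoHundredThirtyOneKinked_piece206⟩
  · exact Or.inr ⟨_, check_UptoHundredThirtyOneKinked_piece207⟩
  · exact Or.inr ⟨_, check_UptoHundredThirtyOneKinked_piece208⟩
  · exact Or.inr ⟨_, check_UptoHundredThirtyOneKinked_piece209⟩
  · exact Or.inr ⟨_, check_UptoHundredThirtyOneKinked_piece210⟩
  · exact Or.inr ⟨_, check_UptoHundredThirtyOneKinked_piece211⟩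
  · exact Or.inr ⟨_, check_UptoHundredThirtyOneKinked_piece212⟩
  · exact Or.inr ⟨_, check_UptoHundredThirtyOneKinked_piece213⟩
  · exact Or.inr ⟨_, check_UptoHundredThirtyOneKinked_piece214⟩
  · exact Or.inr ⟨_, check_UptoHundredThirtyOneKinked_piece215⟩
  · exact Or.inr ⟨_, check_UptoHundredThirtyOneKinked_piece216⟩
  · exact Or.inr ⟨_, check_UptoHundredThirtyOneKinked_piece217⟩
  · exact Or.inr ⟨_, check_UptoHundredThirtyOneKinked_piece218⟩
  · exact Or.inr ⟨_, check_UptoHundredThirtyOneKinked_piece219⟩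
  · exact Or.inr ⟨_, check_UptoHundredThirtyOneKinked_piece220⟩
  · exact Or.inr ⟨_, check_UptoHundredThirtyOneKinked_piece221⟩
  · exact Or.inr ⟨_, check_UptoHundredThirtyOneKinked_piece222⟩
  · exact Or.inr ⟨_, check_UptoHundredThirtyOneKinked_piece223⟩
  · exact Or.inr ⟨_, check_UptoHundredThirtyOneKinked_piece224⟩
  · exact Or.inr ⟨_, check_UptoHundredThirtyOneKinked_piece225⟩
  · exact Or.inr ⟨_, check_UptoHundredThirtyOneKinked_piece226⟩
  · exact Or.inr ⟨_, check_UptoHundredThirtyOneKinked_piece227⟩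
  · exact Or.inr ⟨_, check_UptoHundredThirtyOneKinked_piece228⟩
  · exact Or.inr ⟨_, check_UptoHundredThirtyOneKinked_piece229⟩
  · exact Or.inr ⟨_, check_UptoHundredThirtyOneKinked_piece230⟩
  · exact Or.inr ⟨_, check_UptoHundredThirtyOneKinked_piece231⟩
  · exact Or.inr ⟨_, check_UptoHundredThirtyOneKinked_piece232⟩
  · exact Or.inr ⟨_, check_UptoHundredThirtyOneKinked_piece233⟩
  · exact Or.inr ⟨_, check_UptoHundredThirtyOneKinked_piece234⟩
  · exact Or.inr ⟨_, check_UptoHundredThirtyOneKinked_piece235⟩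
  · exact Or.inr ⟨_, check_UptoHundredThirtyOneKinked_piece236⟩
  · exact Or.inr ⟨_, check_UptoHundredThirtyOneKinked_piece237⟩
  · exact Or.inr ⟨_, check_UptoHundredThirtyOneKinked_piece238⟩
  · exact Or.inr ⟨_, check_UptoHundredThirtyOneKinked_piece239⟩
  · exact Or.inr ⟨_, check_UptoHundredThirtyOneKinked_piece240⟩
  · exact Or.inr ⟨_, check_UptoHundredThirtyOneKinked_piece241⟩
  · exact Or.inr ⟨_, check_UptoHundredThirtyOneKinked_piece242⟩
  · exact Or.inr ⟨_, check_UptoHundredThirtyOneKinked_piece243⟩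
  · exact Or.inr ⟨_, check_UptoHundredThirtyOneKinked_piece244⟩
  · exact Or.inr ⟨_, check_UptoHundredThirtyOneKinked_piece245⟩
  · exact Or.inr ⟨_, check_UptoHundredThirtyOneKinked_piece246⟩
  · exact Or.inr ⟨_, check_UptoHundredThirtyOneKinked_piece247⟩
  · exact Or.inr ⟨_, check_UptoHundredThirtyOneKinked_piece248⟩
  · exact Or.inr ⟨_, check_UptoHundredThirtyOneKinked_piece249⟩
  · exact Or.inr ⟨_, check_UptoHundredThirtyOneKinked_piece250⟩
  · exact Or.inr ⟨_, check_UptoHundredThirtyOneKinked_piece251⟩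
  · exact Or.inr ⟨_, check_UptoHundredThirtyOneKinked_piece252⟩
  · exact Or.inr ⟨_, check_UptoHundredThirtyOneKinked_piece253⟩
  · exact Or.inr ⟨_, check_UptoHundredThirtyOneKinked_piece254⟩
  · exact Or.inr ⟨_, check_UptoHundredThirtyOneKinked_piece255⟩
  · exact Or.inr ⟨_, check_UptoHundredThirtyOneKinked_piece256⟩
  · exact Or.inr ⟨_, check_UptoHundredThirtyOneKinked_piece257⟩
  · exact Or.inr ⟨_, check_UptoHundredThirtyOneKinked_piece258⟩
  · exact Or.inr ⟨_, check_UptoHundredThirtyOneKinked_piece259⟩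
  · exact Or.inr ⟨_, check_UptoHundredThirtyOneKinked_piece260⟩
  · exact Or.inr ⟨_, check_UptoHundredThirtyOneKinked_piece261⟩
  · exact Or.inr ⟨_, check_UptoHundredThirtyOneKinked_piece262⟩
  · exact Or.inr ⟨_, check_UptoHundredThirtyOneKinked_piece263⟩
  · exact Or.inr ⟨_, check_UptoHundredThirtyOneKinked_piece264⟩
  · exact Or.inr ⟨_, check_UptoHundredThirtyOneKinked_piece265⟩
  · exact Or.inr ⟨_, check_UptoHundredThirtyOneKinked_piece266⟩
  · exact Or.inr ⟨_, check_UptoHundredThirtyOneKinked_piece267⟩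
  · exact Or.inr ⟨_, check_UptoHundredThirtyOneKinked_piece268⟩
  · exact Or.inr ⟨_, check_UptoHundredThirtyOneKinked_piece269⟩
  · exact Or.inr ⟨_, check_UptoHundredThirtyOneKinked_piece270⟩
  · exact Or.inr ⟨_, check_UptoHundredThirtyOneKinked_piece271⟩
  · exact Or.inr ⟨_, check_UptoHundredThirtyOneKinked_piece272⟩
  · exact Or.inr ⟨_, check_UptoHundredThirtyOneKinked_piece273⟩
  · exact Or.inr ⟨_, check_UptoHundredThirtyOneKinked_piece274⟩
  · exact Or.inr ⟨_, check_UptoHundredThirtyOneKinked_piece275⟩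
  · exact Or.inr ⟨_, check_UptoHundredThirtyOneKinked_piece276⟩
  · exact Or.inr ⟨_, check_UptoHundredThirtyOneKinked_piece277⟩
  · exact Or.inr ⟨_, check_UptoHundredThirtyOneKinked_piece278⟩
  · exact Or.inr ⟨_, check_UptoHundredThirtyOneKinked_piece279⟩
  · exact Or.inr ⟨_, check_UptoHundredThirtyOneKinked_piece280⟩
  · exact Or.inr ⟨_, check_UptoHundredThirtyOneKinked_piece281⟩
  · exact Or.inr ⟨_, check_UptoHundredThirtyOneKinked_piece282⟩
  · exact Or.inr ⟨_, check_UptoHundredThirtyOneKinked_piece283⟩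
  · exact Or.inr ⟨_, check_UptoHundredThirtyOneKinked_piece284⟩
  · exact Or.inr ⟨_, check_UptoHundredThirtyOneKinked_piece285⟩
  · exact Or.inr ⟨_, check_UptoHundredThirtyOneKinked_piece286⟩
  · exact Or.inr ⟨_, check_UptoHundredThirtyOneKinked_piece287⟩
  · exact Or.inr ⟨_, check_UptoHundredThirtyOneKinked_piece288⟩
  · exact Or.inr ⟨_, check_UptoHundredThirtyOneKinked_piece289⟩
  · exact Or.inr ⟨_, check_UptoHundredThirtyOneKinked_piece290⟩
  · exact Or.inr ⟨_, check_UptoHundredThirtyOneKinked_piece291⟩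
  · exact Or.inr ⟨_, check_UptoHundredThirtyOneKinked_piece292⟩
  · exact Or.inr ⟨_, check_UptoHundredThirtyOneKinked_piece293⟩
  · exact Or.inr ⟨_, check_UptoHundredThirtyOneKinked_piece294⟩
  · exact Or.inr ⟨_, check_UptoHundredThirtyOneKinked_piece295⟩
  · exact Or.inr ⟨_, check_UptoHundredThirtyOneKinked_piece296⟩
  · exact Or.inr ⟨_, check_UptoHundredThirtyOneKinked_piece297⟩
  · exact Or.inr ⟨_, check_UptoHundredThirtyOneKinked_piece298⟩
  · exact Or.inr ⟨_, check_UptoHundredThirtyOneKinked_piece299⟩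

end Summit.RiemannHypothesis.RiemannHypothesis.Theorems.SemilocalPolyWitness

end
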